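import Summits.CriticalPhenomena.PercolationContinuityZ3.Theorems.PercNearOneGluingNoHeavyLowerTailTypedReductions
import Literature.Probability.Percolation.TwoClusterExchange
import HarnessLib

/-!
# `NoHeavyLowerTail` (stmt-CriticalPhenomena-4575) — the WORST-PAIR EXCHANGE: a k-relay analogue of the
# tripod exchange (C⁺) that closes event gluing, `AdditiveGluing` (stmt-4576) and `NoHeavyLowerTail` (stmt-4575)

Support file (prover prim-gen-kcluster, k-cluster conditional-association line; `--supports stmt-CriticalPhenomena-4575`).
No definitions, no named facts, no sorries.

For `μ = prodBernoulli w` on `Fin n`, an observer `o`, a finite relay set `A` and a sink `c`, write for `x ∈ A`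

* `S_x := μ(o ↮ x, o ↮ c, o ↔ A ∖ {x})`  ("`o`'s pocket avoids `x` and the sink but meets another relay"),
* `T_x := μ(o ↮ x, x ↮ c)`, and `d_x := μ(x ↮ c)`.

EVENT GLUING `EG` (the strong event form of Kozma–Nitzan's additive conjecture; for `|A| ≤ 2` it is the
landed `Theorems.eventGluing_card_le_two`, from C⁺) is `μ({o ↮ c} ∩ ⋃_{a ∈ A} {o ↔ a}) ≤ max_{a ∈ A} d_a`.
Bookkeeping: `EG ⟺ ∃ x ∈ A, S_x ≤ T_x` with `x` a relay of maximal `d_x` (`eventGluing_of_exists`).  For two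
relays the tree's proof is the PRODUCT inequality `S_a S_b ≤ T_a T_b` — one instance of the two-cluster
exchange `Literature.Probability.Percolation.twoClusterExchange` (BHK 2006 Thm 1.5) — followed by
"a product of two numbers is ≤ a product of two numbers ⇒ one factor is ≤" (`worstPairExchange_two` below,
PROVED).  THE WORST-PAIR EXCHANGE (conjectural for `|A| ≥ 3`; numerics in the seat's notes: 0 violations in
> 10⁴ exact instances incl. adversarial annealing, while every other pair of relays and the triple product fail):

  `WPE : if a ≠ b ∈ A and d_x ≤ min(d_a, d_b) for every other x ∈ A, then S_a · S_b ≤ T_a · T_b.`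

THIS FILE (all sorry-free):
* `worstPairExchange_two` — `WPE` for `A = {a, b}` (no hypothesis needed), from `twoClusterExchange`;
* `eventGluing_of_worstPairExchange` — `WPE` (all `A`) ⇒ `EG` (all `A`): choose the two worst relays;
* `additiveGluing_of_eventGluing`, `noHeavyLowerTail_of_eventGluing` — `EG` ⇒ both cruxes of the route
  (`AdditiveGluing` directly; `NoHeavyLowerTail` through `additiveGluingSuffices_proof`,
  `manyFingersLargePocket_of_nearOneGluing`, `noHeavyLowerTail_of_manyFingersLargePocket`);
* `additiveGluing_of_worstPairExchange`, `noHeavyLowerTail_of_worstPairExchange` — the compositions.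
-/

noncomputable section

namespace Summit.CriticalPhenomena.PercolationContinuityZ3.Theorems

open MeasureTheory Set Literature.Probability.LatticeModels Literature.Probability.Percolation
open Summit.CriticalPhenomena.PercolationContinuityZ3.Theses.PercNearOneGluing
open scoped Classical BigOperators

namespace WorstPairExchange

variable {n : ℕ}

/-- The pocket event `S_x`: `o ↮ x`, `o ↮ c`, and `o ↔ y` for some relay `y ∈ A ∖ {x}`. [this file] -/
theorem pocket_def (A : Finset (Fin n)) (o c x : Fin n) :
    ((openConn o x : Set (BondConfig (Fin n)))ᶜ ∩ (openConn o c)ᶜ ∩ ⋃ y ∈ A.erase x, openConn o y) =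
      {ω : BondConfig (Fin n) | ¬ (openGraph ω).Reachable o x ∧ ¬ (openGraph ω).Reachable o c ∧
        ∃ y ∈ A.erase x, (openGraph ω).Reachable o y} := by
  ext ω
  simp only [mem_inter_iff, mem_compl_iff, mem_iUnion, exists_prop, mem_setOf_eq, openConn, and_assoc]

/-- Splitting the exit event at a relay `x ∈ A`:
`{o ↮ c} ∩ ⋃_{y ∈ A} {o ↔ y} ⊆ ({o ↔ x} ∩ {x ↮ c}) ∪ S_x`. [folklore] -/
theorem exit_subset (A : Finset (Fin n)) (o c x : Fin n) :
    ((openConn o c : Set (BondConfig (Fin n)))ᶜ ∩ ⋃ y ∈ A, openConn o y) ⊆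
      ((openConn o x : Set (BondConfig (Fin n))) ∩ (openConn x c)ᶜ) ∪
        ((openConn o x : Set (BondConfig (Fin n)))ᶜ ∩ (openConn o c)ᶜ ∩ ⋃ y ∈ A.erase x, openConn o y) := by
  intro ω hω
  rcases hω with ⟨hoc, hU⟩
  simp only [mem_iUnion, exists_prop] at hU
  obtain ⟨y, hyA, hoy⟩ := hU
  by_cases hox : ω ∈ (openConn o x : Set (BondConfig (Fin n)))
  · left
    refine ⟨hox, ?_⟩
    intro hxc
    exact hoc (SimpleGraph.Reachable.trans (show (openGraph ω).Reachable o x from hox) hxc)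
  · right
    refine ⟨⟨hox, hoc⟩, ?_⟩
    simp only [mem_iUnion, exists_prop]
    have hyx : y ≠ x := by
      rintro rfl
      exact hox hoy
    exact ⟨y, Finset.mem_erase.2 ⟨hyx, hyA⟩, hoy⟩

/-- `μ({o ↔ x} ∩ {x ↮ c}) + μ({o ↮ x} ∩ {x ↮ c}) = μ{x ↮ c}`. [folklore] -/
theorem split_disconnection (w : Sym2 (Fin n) → unitInterval) (o c x : Fin n) :
    (prodBernoulli w).real ((openConn o x : Set (BondConfig (Fin n))) ∩ (openConn x c)ᶜ) +
        (prodBernoulli w).real ((openConn o x : Set (BondConfig (Fin n)))ᶜ ∩ (openConn x c)ᶜ) =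
      (prodBernoulli w).real (openConn x c : Set (BondConfig (Fin n)))ᶜ := by
  rw [← measureReal_union (Set.disjoint_left.2 fun ω h1 h2 => h2.1 h1.1) MeasurableSet.of_discrete]
  congr 1
  ext ω
  simp only [mem_union, mem_inter_iff, mem_compl_iff]
  tauto

/-- **Bookkeeping**: if some relay `x ∈ A` has `S_x ≤ T_x` and `d_x ≤ s`, then the exit event has
probability `≤ s`. [folklore] -/
theorem exit_le_of_pocket_le (w : Sym2 (Fin n) → unitInterval) (A : Finset (Fin n)) (o c x : Fin n)
    (s : ℝ) (hdx : (prodBernoulli w).real (openConn x c : Set (BondConfig (Fin n)))ᶜ ≤ s)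
    (hST : (prodBernoulli w).real
        ((openConn o x : Set (BondConfig (Fin n)))ᶜ ∩ (openConn o c)ᶜ ∩ ⋃ y ∈ A.erase x, openConn o y) ≤
      (prodBernoulli w).real ((openConn o x : Set (BondConfig (Fin n)))ᶜ ∩ (openConn x c)ᶜ)) :
    (prodBernoulli w).real ((openConn o c : Set (BondConfig (Fin n)))ᶜ ∩ ⋃ y ∈ A, openConn o y) ≤ s := by
  calc (prodBernoulli w).real ((openConn o c : Set (BondConfig (Fin n)))ᶜ ∩ ⋃ y ∈ A, openConn o y)
      ≤ (prodBernoulli w).real (((openConn o x : Set (BondConfig (Fin n))) ∩ (openConn x c)ᶜ) ∪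
          ((openConn o x : Set (BondConfig (Fin n)))ᶜ ∩ (openConn o c)ᶜ ∩ ⋃ y ∈ A.erase x, openConn o y)) :=
        measureReal_mono (exit_subset A o c x)
    _ ≤ (prodBernoulli w).real ((openConn o x : Set (BondConfig (Fin n))) ∩ (openConn x c)ᶜ) +
          (prodBernoulli w).real
            ((openConn o x : Set (BondConfig (Fin n)))ᶜ ∩ (openConn o c)ᶜ ∩ ⋃ y ∈ A.erase x, openConn o y) :=
        measureReal_union_le _ _
    _ ≤ (prodBernoulli w).real ((openConn o x : Set (BondConfig (Fin n))) ∩ (openConn x c)ᶜ) +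
          (prodBernoulli w).real ((openConn o x : Set (BondConfig (Fin n)))ᶜ ∩ (openConn x c)ᶜ) := by
        linarith
    _ = (prodBernoulli w).real (openConn x c : Set (BondConfig (Fin n)))ᶜ := split_disconnection w o c x
    _ ≤ s := hdx

/-- From a product inequality `S_a S_b ≤ T_a T_b` between nonnegative reals, one factor comparison holds.
[folklore] -/
theorem le_or_le_of_mul_le_mul {Sa Sb Ta Tb : ℝ} (hTa : 0 ≤ Ta) (hTb : 0 ≤ Tb)
    (h : Sa * Sb ≤ Ta * Tb) : Sa ≤ Ta ∨ Sb ≤ Tb := by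
  by_contra hnot
  push Not at hnot
  have := mul_lt_mul'' hnot.1 hnot.2 hTa hTb
  linarith

end WorstPairExchange

open WorstPairExchange

/-- **Worst-pair exchange for two relays (PROVED; no hypothesis on the sink distances).**
For distinct relays `a, b`, an observer `o` and a sink `c`:
`μ(o↮a, o↮c, o↔b) · μ(o↮b, o↮c, o↔a) ≤ μ(o↮a, a↮c) · μ(o↮b, b↮c)`.
One instance of the two-cluster exchange with clusters `C_b` (`s`) and `C_a` (`t`) on `{a ↮ b}`:
`A₁ = {b ↔ o}`, `B₁ = {b ↮ c}`, `A₂ = {a ↮ c}`, `B₂ = {a ↔ o}`.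
[cite: VandenbergHaggstromKahn2005, Thm. 1.5 (p. 7) — corollary via `twoClusterExchange`] -/
theorem worstPairExchange_two {n : ℕ} (w : Sym2 (Fin n) → unitInterval) (o c a b : Fin n) (hab : a ≠ b) :
    (prodBernoulli w).real ((openConn o a : Set (BondConfig (Fin n)))ᶜ ∩ (openConn o c)ᶜ ∩ openConn o b) *
        (prodBernoulli w).real ((openConn o b : Set (BondConfig (Fin n)))ᶜ ∩ (openConn o c)ᶜ ∩ openConn o a) ≤
      (prodBernoulli w).real ((openConn o a : Set (BondConfig (Fin n)))ᶜ ∩ (openConn a c)ᶜ) *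
        (prodBernoulli w).real ((openConn o b : Set (BondConfig (Fin n)))ᶜ ∩ (openConn b c)ᶜ) := by
  set μ := prodBernoulli w with hμ
  have hba : b ≠ a := fun h => hab h.symm
  -- the exchange instance: s = b, t = a
  have hex := twoClusterExchange w hba
    (A₁ := (openConn b o : Set (BondConfig (Fin n)))) (B₁ := (openConn b c : Set (BondConfig (Fin n)))ᶜ)
    (A₂ := (openConn a c : Set (BondConfig (Fin n)))ᶜ) (B₂ := (openConn a o : Set (BondConfig (Fin n))))
    (fun ω ω' h1 h2 hω => typePlus_openConn b a o h1 h2 hω)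
    (fun ω ω' h1 h2 hω => typePlus_not_openConn b a c h1 h2 hω)
    (fun ω ω' h1 h2 hω => typeMinus_not_openConn b a c h1 h2 hω)
    (fun ω ω' h1 h2 hω => typeMinus_openConn b a o h1 h2 hω)
  -- compare the four events
  have rs : ∀ {x y : Fin n} {ω : BondConfig (Fin n)}, (openGraph ω).Reachable x y → (openGraph ω).Reachable y x :=
    fun h => h.symm
  have hL1 : ((openConn o a : Set (BondConfig (Fin n)))ᶜ ∩ (openConn o c)ᶜ ∩ openConn o b) ⊆
      (openConn b a)ᶜ ∩ ((openConn b o : Set (BondConfig (Fin n))) ∩ (openConn b c)ᶜ) := by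
    intro ω hω
    rcases hω with ⟨⟨hoa, hoc⟩, hob⟩
    refine ⟨fun hba' => hoa (SimpleGraph.Reachable.trans hob hba'), rs hob, fun hbc => hoc ?_⟩
    exact SimpleGraph.Reachable.trans hob hbc
  have hL2 : ((openConn o b : Set (BondConfig (Fin n)))ᶜ ∩ (openConn o c)ᶜ ∩ openConn o a) ⊆
      (openConn b a)ᶜ ∩ ((openConn a c : Set (BondConfig (Fin n)))ᶜ ∩ openConn a o) := by
    intro ω hω
    rcases hω with ⟨⟨hob, hoc⟩, hoa⟩
    refine ⟨fun hba' => hob (SimpleGraph.Reachable.trans hoa (rs hba')), fun hac => hoc ?_, rs hoa⟩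
    exact SimpleGraph.Reachable.trans hoa hac
  have hR1 : (openConn b a)ᶜ ∩ ((openConn b o : Set (BondConfig (Fin n))) ∩ (openConn a c)ᶜ) ⊆
      ((openConn o a : Set (BondConfig (Fin n)))ᶜ ∩ (openConn a c)ᶜ) := by
    intro ω hω
    rcases hω with ⟨hba', hbo, hac⟩
    exact ⟨fun hoa => hba' (SimpleGraph.Reachable.trans hbo hoa), hac⟩
  have hR2 : (openConn b a)ᶜ ∩ ((openConn b c : Set (BondConfig (Fin n)))ᶜ ∩ openConn a o) ⊆
      ((openConn o b : Set (BondConfig (Fin n)))ᶜ ∩ (openConn b c)ᶜ) := by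
    intro ω hω
    rcases hω with ⟨hba', hbc, hao⟩
    exact ⟨fun hob => hba' (rs (SimpleGraph.Reachable.trans hao hob)), hbc⟩
  have m1 := measureReal_mono (μ := μ) hL1
  have m2 := measureReal_mono (μ := μ) hL2
  have m3 := measureReal_mono (μ := μ) hR1
  have m4 := measureReal_mono (μ := μ) hR2
  have n1 : 0 ≤ μ.real ((openConn o a : Set (BondConfig (Fin n)))ᶜ ∩ (openConn o c)ᶜ ∩ openConn o b) :=
    measureReal_nonneg
  have n2 : 0 ≤ μ.real ((openConn o b : Set (BondConfig (Fin n)))ᶜ ∩ (openConn o c)ᶜ ∩ openConn o a) :=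
    measureReal_nonneg
  have n3 : 0 ≤ μ.real ((openConn b a)ᶜ ∩ ((openConn b o : Set (BondConfig (Fin n))) ∩ (openConn a c)ᶜ)) :=
    measureReal_nonneg
  calc μ.real ((openConn o a : Set (BondConfig (Fin n)))ᶜ ∩ (openConn o c)ᶜ ∩ openConn o b) *
        μ.real ((openConn o b : Set (BondConfig (Fin n)))ᶜ ∩ (openConn o c)ᶜ ∩ openConn o a)
      ≤ μ.real ((openConn b a)ᶜ ∩ ((openConn b o : Set (BondConfig (Fin n))) ∩ (openConn b c)ᶜ)) *
          μ.real ((openConn b a)ᶜ ∩ ((openConn a c : Set (BondConfig (Fin n)))ᶜ ∩ openConn a o)) :=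
        mul_le_mul m1 m2 n2 (le_trans n1 m1)
    _ ≤ μ.real ((openConn b a)ᶜ ∩ ((openConn b o : Set (BondConfig (Fin n))) ∩ (openConn a c)ᶜ)) *
          μ.real ((openConn b a)ᶜ ∩ ((openConn b c : Set (BondConfig (Fin n)))ᶜ ∩ openConn a o)) := hex
    _ ≤ μ.real ((openConn o a : Set (BondConfig (Fin n)))ᶜ ∩ (openConn a c)ᶜ) *
          μ.real ((openConn o b : Set (BondConfig (Fin n)))ᶜ ∩ (openConn b c)ᶜ) :=
        mul_le_mul m3 m4 measureReal_nonneg (le_trans n3 m3)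

/-- **Worst-pair exchange ⇒ event gluing (all relay sets).**  Hypothesis (verbatim the conjecture WPE):
for every finite weighted graph, observer `o`, sink `c`, relay set `A` and distinct `a, b ∈ A` such that every
other relay `x ∈ A` has `μ(x ↮ c) ≤ μ(a ↮ c)` and `μ(x ↮ c) ≤ μ(b ↮ c)`, the product inequality
`S_a S_b ≤ T_a T_b` holds.  Conclusion: `μ({o ↮ c} ∩ ⋃_{a ∈ A}{o ↔ a}) ≤ s` whenever `μ(a ↮ c) ≤ s` on `A`.
Proof: pick `a` of maximal `μ(· ↮ c)` on `A` and `b` of maximal `μ(· ↮ c)` on `A ∖ {a}`; by WPE and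
`le_or_le_of_mul_le_mul` some `x ∈ {a, b}` has `S_x ≤ T_x`; conclude by `exit_le_of_pocket_le`. [this file] -/
theorem eventGluing_of_worstPairExchange
    (hWPE : ∀ (n : ℕ) (w : Sym2 (Fin n) → unitInterval) (A : Finset (Fin n)) (o c a b : Fin n),
      a ∈ A → b ∈ A → a ≠ b →
      (∀ x ∈ A, x ≠ a → x ≠ b →
        (prodBernoulli w).real (openConn x c : Set (BondConfig (Fin n)))ᶜ ≤
            (prodBernoulli w).real (openConn a c : Set (BondConfig (Fin n)))ᶜ ∧
          (prodBernoulli w).real (openConn x c : Set (BondConfig (Fin n)))ᶜ ≤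
            (prodBernoulli w).real (openConn b c : Set (BondConfig (Fin n)))ᶜ) →
      (prodBernoulli w).real
          ((openConn o a : Set (BondConfig (Fin n)))ᶜ ∩ (openConn o c)ᶜ ∩ ⋃ y ∈ A.erase a, openConn o y) *
        (prodBernoulli w).real
          ((openConn o b : Set (BondConfig (Fin n)))ᶜ ∩ (openConn o c)ᶜ ∩ ⋃ y ∈ A.erase b, openConn o y) ≤
      (prodBernoulli w).real ((openConn o a : Set (BondConfig (Fin n)))ᶜ ∩ (openConn a c)ᶜ) *
        (prodBernoulli w).real ((openConn o b : Set (BondConfig (Fin n)))ᶜ ∩ (openConn b c)ᶜ)) :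
    ∀ (n : ℕ) (w : Sym2 (Fin n) → unitInterval) (A : Finset (Fin n)) (o c : Fin n) (s : ℝ), 0 ≤ s →
      (∀ a ∈ A, (prodBernoulli w).real (openConn a c : Set (BondConfig (Fin n)))ᶜ ≤ s) →
      (prodBernoulli w).real ((openConn o c : Set (BondConfig (Fin n)))ᶜ ∩ ⋃ a ∈ A, openConn o a) ≤ s := by
  intro n w A o c s hs hcut
  set μ := prodBernoulli w with hμ
  set d : Fin n → ℝ := fun x => μ.real (openConn x c : Set (BondConfig (Fin n)))ᶜ with hd
  rcases A.eq_empty_or_nonempty with hAe | hAne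
  · subst hAe
    simp only [Finset.notMem_empty, Set.iUnion_of_empty, Set.iUnion_empty, Set.inter_empty,
      measureReal_empty]
    exact hs
  obtain ⟨a, haA, hamax⟩ := Finset.exists_max_image A d hAne
  rcases (A.erase a).eq_empty_or_nonempty with hA1 | hA2
  · -- a single relay: the exit event forces `a ↮ c`
    refine exit_le_of_pocket_le w A o c a s (hcut a haA) ?_
    rw [hA1]
    simp only [Finset.notMem_empty, Set.iUnion_of_empty, Set.iUnion_empty, Set.inter_empty,
      measureReal_empty]
    exact measureReal_nonneg
  obtain ⟨b, hbA', hbmax⟩ := Finset.exists_max_image (A.erase a) d hA2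
  have hbA : b ∈ A := Finset.mem_of_mem_erase hbA'
  have hab : a ≠ b := fun h => (Finset.mem_erase.1 hbA').1 h.symm
  have hothers : ∀ x ∈ A, x ≠ a → x ≠ b → d x ≤ d a ∧ d x ≤ d b := fun x hx hxa _ =>
    ⟨hamax x hx, hbmax x (Finset.mem_erase.2 ⟨hxa, hx⟩)⟩
  have hprod := hWPE n w A o c a b haA hbA hab hothers
  rcases le_or_le_of_mul_le_mul measureReal_nonneg measureReal_nonneg hprod with h | h
  · exact exit_le_of_pocket_le w A o c a s (hcut a haA) h
  · exact exit_le_of_pocket_le w A o c b s (hcut b hbA) h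

/-- **Event gluing ⇒ `AdditiveGluing`** (stmt-CriticalPhenomena-4576):
`μ(o ↔ A) ≤ μ(o ↔ b) + μ({o ↮ b} ∩ {o ↔ A}) ≤ μ(o ↔ b) + t`. [folklore] -/
theorem additiveGluing_of_eventGluing
    (hEG : ∀ (n : ℕ) (w : Sym2 (Fin n) → unitInterval) (A : Finset (Fin n)) (o c : Fin n) (s : ℝ), 0 ≤ s →
      (∀ a ∈ A, (prodBernoulli w).real (openConn a c : Set (BondConfig (Fin n)))ᶜ ≤ s) →
      (prodBernoulli w).real ((openConn o c : Set (BondConfig (Fin n)))ᶜ ∩ ⋃ a ∈ A, openConn o a) ≤ s) :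
    Summit.CriticalPhenomena.PercolationContinuityZ3.Theses.PercNearOneGluing.AdditiveGluing := by
  intro n w A o b t ht hrel
  set μ := prodBernoulli w with hμ
  haveI : IsProbabilityMeasure μ := by rw [hμ]; infer_instance
  have hcut : ∀ a ∈ A, μ.real (openConn a b : Set (BondConfig (Fin n)))ᶜ ≤ t := by
    intro a ha
    have h1 := hrel a ha
    have h2 : μ.real (openConn a b : Set (BondConfig (Fin n)))ᶜ =
        1 - μ.real (openConn a b : Set (BondConfig (Fin n))) :=
      probReal_compl_eq_one_sub MeasurableSet.of_discrete
    linarith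
  have hEG' := hEG n w A o b t ht hcut
  have hsplit : μ.real (⋃ a ∈ A, (openConn o a : Set (BondConfig (Fin n)))) ≤
      μ.real (openConn o b : Set (BondConfig (Fin n))) +
        μ.real ((openConn o b : Set (BondConfig (Fin n)))ᶜ ∩ ⋃ a ∈ A, openConn o a) := by
    calc μ.real (⋃ a ∈ A, (openConn o a : Set (BondConfig (Fin n))))
        ≤ μ.real ((openConn o b : Set (BondConfig (Fin n))) ∪
            ((openConn o b : Set (BondConfig (Fin n)))ᶜ ∩ ⋃ a ∈ A, openConn o a)) := by
          refine measureReal_mono fun ω hω => ?_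
          by_cases hob : ω ∈ (openConn o b : Set (BondConfig (Fin n)))
          · exact Or.inl hob
          · exact Or.inr ⟨hob, hω⟩
      _ ≤ _ := measureReal_union_le _ _
  linarith

/-- **Event gluing ⇒ `NoHeavyLowerTail`** (stmt-CriticalPhenomena-4575), through `AdditiveGluing ⇒ NearOneGluing`
(`additiveGluingSuffices_proof`) and the landed residual reductions. [folklore] -/
theorem noHeavyLowerTail_of_eventGluing
    (hEG : ∀ (n : ℕ) (w : Sym2 (Fin n) → unitInterval) (A : Finset (Fin n)) (o c : Fin n) (s : ℝ), 0 ≤ s →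
      (∀ a ∈ A, (prodBernoulli w).real (openConn a c : Set (BondConfig (Fin n)))ᶜ ≤ s) →
      (prodBernoulli w).real ((openConn o c : Set (BondConfig (Fin n)))ᶜ ∩ ⋃ a ∈ A, openConn o a) ≤ s) :
    Summit.CriticalPhenomena.PercolationContinuityZ3.Theses.PercNearOneGluing.NoHeavyLowerTail :=
  noHeavyLowerTail_of_manyFingersLargePocket
    (manyFingersLargePocket_of_nearOneGluing
      (additiveGluingSuffices_proof (additiveGluing_of_eventGluing hEG)))

/-- **Worst-pair exchange ⇒ `AdditiveGluing`** (stmt-CriticalPhenomena-4576). [this file] -/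
theorem additiveGluing_of_worstPairExchange
    (hWPE : ∀ (n : ℕ) (w : Sym2 (Fin n) → unitInterval) (A : Finset (Fin n)) (o c a b : Fin n),
      a ∈ A → b ∈ A → a ≠ b →
      (∀ x ∈ A, x ≠ a → x ≠ b →
        (prodBernoulli w).real (openConn x c : Set (BondConfig (Fin n)))ᶜ ≤
            (prodBernoulli w).real (openConn a c : Set (BondConfig (Fin n)))ᶜ ∧
          (prodBernoulli w).real (openConn x c : Set (BondConfig (Fin n)))ᶜ ≤
            (prodBernoulli w).real (openConn b c : Set (BondConfig (Fin n)))ᶜ) →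
      (prodBernoulli w).real
          ((openConn o a : Set (BondConfig (Fin n)))ᶜ ∩ (openConn o c)ᶜ ∩ ⋃ y ∈ A.erase a, openConn o y) *
        (prodBernoulli w).real
          ((openConn o b : Set (BondConfig (Fin n)))ᶜ ∩ (openConn o c)ᶜ ∩ ⋃ y ∈ A.erase b, openConn o y) ≤
      (prodBernoulli w).real ((openConn o a : Set (BondConfig (Fin n)))ᶜ ∩ (openConn a c)ᶜ) *
        (prodBernoulli w).real ((openConn o b : Set (BondConfig (Fin n)))ᶜ ∩ (openConn b c)ᶜ)) :
    Summit.CriticalPhenomena.PercolationContinuityZ3.Theses.PercNearOneGluing.AdditiveGluing :=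
  additiveGluing_of_eventGluing (eventGluing_of_worstPairExchange hWPE)

/-- **Worst-pair exchange ⇒ `NoHeavyLowerTail`** (stmt-CriticalPhenomena-4575). [this file] -/
theorem noHeavyLowerTail_of_worstPairExchange
    (hWPE : ∀ (n : ℕ) (w : Sym2 (Fin n) → unitInterval) (A : Finset (Fin n)) (o c a b : Fin n),
      a ∈ A → b ∈ A → a ≠ b →
      (∀ x ∈ A, x ≠ a → x ≠ b →
        (prodBernoulli w).real (openConn x c : Set (BondConfig (Fin n)))ᶜ ≤
            (prodBernoulli w).real (openConn a c : Set (BondConfig (Fin n)))ᶜ ∧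
          (prodBernoulli w).real (openConn x c : Set (BondConfig (Fin n)))ᶜ ≤
            (prodBernoulli w).real (openConn b c : Set (BondConfig (Fin n)))ᶜ) →
      (prodBernoulli w).real
          ((openConn o a : Set (BondConfig (Fin n)))ᶜ ∩ (openConn o c)ᶜ ∩ ⋃ y ∈ A.erase a, openConn o y) *
        (prodBernoulli w).real
          ((openConn o b : Set (BondConfig (Fin n)))ᶜ ∩ (openConn o c)ᶜ ∩ ⋃ y ∈ A.erase b, openConn o y) ≤
      (prodBernoulli w).real ((openConn o a : Set (BondConfig (Fin n)))ᶜ ∩ (openConn a c)ᶜ) *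
        (prodBernoulli w).real ((openConn o b : Set (BondConfig (Fin n)))ᶜ ∩ (openConn b c)ᶜ)) :
    Summit.CriticalPhenomena.PercolationContinuityZ3.Theses.PercNearOneGluing.NoHeavyLowerTail :=
  noHeavyLowerTail_of_eventGluing (eventGluing_of_worstPairExchange hWPE)

/-- **Event gluing for `|A| ≤ 2`, recovered** from `worstPairExchange_two` + the bookkeeping (sanity check of the
shapes; cf. the landed `Theorems.eventGluing_card_le_two`). [this file] -/
theorem eventGluing_pair {n : ℕ} (w : Sym2 (Fin n) → unitInterval) (o c a b : Fin n) (hab : a ≠ b) (s : ℝ)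
    (ha : (prodBernoulli w).real (openConn a c : Set (BondConfig (Fin n)))ᶜ ≤ s)
    (hb : (prodBernoulli w).real (openConn b c : Set (BondConfig (Fin n)))ᶜ ≤ s) :
    (prodBernoulli w).real ((openConn o c : Set (BondConfig (Fin n)))ᶜ ∩ ⋃ y ∈ ({a, b} : Finset (Fin n)),
      openConn o y) ≤ s := by
  have hprod := worstPairExchange_two w o c a b hab
  have hea : ({a, b} : Finset (Fin n)).erase a = {b} := by
    ext x
    simp only [Finset.mem_erase, Finset.mem_insert, Finset.mem_singleton]
    constructor
    · rintro ⟨hxa, hx | hx⟩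
      · exact absurd hx hxa
      · exact hx
    · rintro rfl
      exact ⟨fun h => hab h.symm, Or.inr rfl⟩
  have heb : ({a, b} : Finset (Fin n)).erase b = {a} := by
    ext x
    simp only [Finset.mem_erase, Finset.mem_insert, Finset.mem_singleton]
    constructor
    · rintro ⟨hxb, hx | hx⟩
      · exact hx
      · exact absurd hx hxb
    · rintro rfl
      exact ⟨hab, Or.inl rfl⟩
  have e1 : ((openConn o a : Set (BondConfig (Fin n)))ᶜ ∩ (openConn o c)ᶜ ∩
      ⋃ y ∈ ({a, b} : Finset (Fin n)).erase a, openConn o y) =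
      ((openConn o a : Set (BondConfig (Fin n)))ᶜ ∩ (openConn o c)ᶜ ∩ openConn o b) := by
    rw [hea]; simp only [Finset.mem_singleton, Set.iUnion_iUnion_eq_left]
  have e2 : ((openConn o b : Set (BondConfig (Fin n)))ᶜ ∩ (openConn o c)ᶜ ∩
      ⋃ y ∈ ({a, b} : Finset (Fin n)).erase b, openConn o y) =
      ((openConn o b : Set (BondConfig (Fin n)))ᶜ ∩ (openConn o c)ᶜ ∩ openConn o a) := by
    rw [heb]; simp only [Finset.mem_singleton, Set.iUnion_iUnion_eq_left]
  rw [← e1, ← e2] at hprod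
  rcases le_or_le_of_mul_le_mul measureReal_nonneg measureReal_nonneg hprod with h | h
  · exact exit_le_of_pocket_le w {a, b} o c a s ha h
  · exact exit_le_of_pocket_le w {a, b} o c b s hb h

end Summit.CriticalPhenomena.PercolationContinuityZ3.Theorems

end
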